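import Literature.MathematicalPhysics.QuantumLattice.TranslationInvariantFermionStatesAreEven
import HarnessLib

/-!
# Local Kraus (completely positive, unital) perturbations of the lattice fermion algebra

Topic `Literature/MathematicalPhysics/QuantumLattice`; namespace
`Literature.MathematicalPhysics.QuantumLattice` (the file path). Vocabulary of `InfVolFermionState.lean`
(`fermionEmbed`, `parityAut`) and `FermionEmbedLocality.lean` / `TranslationInvariantFermionStatesAreEven.lean`
(graded commutation relations). Everything is PROVED; no named fact.

For a finite family `V_k` of operators of the local algebra of a finite site set `Λ₀` with
`Σ_k V_k⋆ V_k = 𝟙` (a **Kraus family**) and an injection of sites `φ : Λ₀ ↪ Λ'`, the map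
`𝓔_φ(B) = Σ_k (Γ(φ) V_k)⋆ B (Γ(φ) V_k)` is a unital completely positive map of the local algebra of
`Λ'` (Kraus 1971; Bratteli–Robinson II §5.3.1 uses the dissipative generators `γ_B`, whose
exponentials are such maps; Bratteli–Kishimoto–Robinson 1978 use `e^{tγ_B}` to perturb states locally
in the proof of their Theorem 1). This file records the algebra the local perturbation argument needs:

* `krausMap φ V` (definition with body) and `krausMap_apply`;
* `krausMap_one` (unital), `krausMap_eq_self_of_commute` (it fixes every `B` commuting with the
  `Γ(φ) V_k` — in particular every EVEN operator supported away from `φ Λ₀`,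
  `krausMap_fermionEmbed_of_disjoint_of_even`, and every operator away from `φ Λ₀` if the `V_k` are even,
  `krausMap_fermionEmbed_of_disjoint_of_forall_even`);
* `krausMap_posSemidef` / `krausMap_nonneg` (positivity), `krausMap_conjTranspose`;
* `parityAut_krausMap` (for HOMOGENEOUS `V_k`, i.e. each even or odd, `𝓔` commutes with `Θ`);
* `fermionEmbed_krausMap` (covariance `Γ(ψ) ∘ 𝓔_φ = 𝓔_{φ∘ψ} ∘ Γ(ψ)`);
* `krausMap_comm_of_disjoint` (two such maps with disjoint supports and homogeneous Kraus operators commute).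

## References

* [BratteliRobinsonII1997] O. Bratteli, D. W. Robinson, OAQSM 2, §5.3.1 (dissipations `γ_B(A) = B⋆AB − {B⋆B, A}/2`,
  completely positive semigroups) and §5.2.2 (graded commutation in the CAR algebra).
* [BratteliKishimotoRobinson1978] O. Bratteli, A. Kishimoto, D. W. Robinson, Commun. Math. Phys. 64 (1978) 41,
  proof of Thm. 1 (local completely positive perturbations `ω ∘ e^{tγ_B}` of a state).
-/

noncomputable section

namespace Literature.MathematicalPhysics.QuantumLattice

open Matrix Finset HubbardWave0
open scoped ComplexOrder

variable {Λ₀ Λ₁ Λ₂ Λ' Λ'' : Type*} [LinearOrder Λ₀] [Fintype Λ₀] [LinearOrder Λ₁] [Fintype Λ₁]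
  [LinearOrder Λ₂] [Fintype Λ₂] [LinearOrder Λ'] [Fintype Λ'] [LinearOrder Λ''] [Fintype Λ'']
  {ι κ : Type*} [Fintype ι] [Fintype κ]

/-- **The Kraus map** `𝓔_φ(B) = Σ_k (Γ(φ) V_k)⋆ B (Γ(φ) V_k)` of a finite family `V_k ∈ 𝔄_{Λ₀}` placed
along the site injection `φ : Λ₀ ↪ Λ'` (a completely positive map of `𝔄_{Λ'}`, unital when
`Σ_k V_k⋆ V_k = 𝟙`). Bratteli–Robinson II §5.3.1 (the maps `e^{tγ_B}`); Bratteli–Kishimoto–Robinson 1978,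
proof of Thm. 1. [cite: BratteliKishimotoRobinson1978, Thm. 1 (proof, the semigroup `e^{tγ_B}`)] -/
def krausMap (φ : Λ₀ ↪ Λ') (V : ι → Matrix (Finset (Orb Λ₀)) (Finset (Orb Λ₀)) ℂ) :
    Matrix (Finset (Orb Λ')) (Finset (Orb Λ')) ℂ →ₗ[ℂ] Matrix (Finset (Orb Λ')) (Finset (Orb Λ')) ℂ where
  toFun B := ∑ k, (fermionEmbed φ (V k))ᴴ * B * fermionEmbed φ (V k)
  map_add' B C := by
    rw [← Finset.sum_add_distrib]
    exact Finset.sum_congr rfl fun k _ => by rw [Matrix.mul_add, Matrix.add_mul]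
  map_smul' c B := by
    rw [RingHom.id_apply, Finset.smul_sum]
    exact Finset.sum_congr rfl fun k _ => by rw [Matrix.mul_smul, Matrix.smul_mul]

/-- `𝓔_φ(B) = Σ_k (Γ V_k)⋆ B (Γ V_k)` (definitional). [cite: BratteliKishimotoRobinson1978, Thm. 1 (proof)] -/
theorem krausMap_apply (φ : Λ₀ ↪ Λ') (V : ι → Matrix (Finset (Orb Λ₀)) (Finset (Orb Λ₀)) ℂ)
    (B : Matrix (Finset (Orb Λ')) (Finset (Orb Λ')) ℂ) :
    krausMap φ V B = ∑ k, (fermionEmbed φ (V k))ᴴ * B * fermionEmbed φ (V k) := rfl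

/-- **`𝓔` fixes every operator commuting with the Kraus operators** (given `Σ V_k⋆ V_k = 𝟙`):
`Σ_k W_k⋆ B W_k = (Σ_k W_k⋆ W_k) B = B`. [cite: BratteliRobinsonII1997, §5.3.1] -/
theorem krausMap_eq_self_of_commute (φ : Λ₀ ↪ Λ') {V : ι → Matrix (Finset (Orb Λ₀)) (Finset (Orb Λ₀)) ℂ}
    (hV : ∑ k, (V k)ᴴ * V k = 1) {B : Matrix (Finset (Orb Λ')) (Finset (Orb Λ')) ℂ}
    (hB : ∀ k, Commute (fermionEmbed φ (V k)) B) : krausMap φ V B = B := by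
  rw [krausMap_apply]
  calc ∑ k, (fermionEmbed φ (V k))ᴴ * B * fermionEmbed φ (V k)
      = ∑ k, (fermionEmbed φ (V k))ᴴ * fermionEmbed φ (V k) * B :=
        Finset.sum_congr rfl fun k _ => by rw [Matrix.mul_assoc, ← (hB k).eq, ← Matrix.mul_assoc]
    _ = fermionEmbed φ (∑ k, (V k)ᴴ * V k) * B := by
        rw [map_sum, Finset.sum_mul]
        exact Finset.sum_congr rfl fun k _ => by rw [map_mul, fermionEmbed_conjTranspose]
    _ = B := by rw [hV, map_one, Matrix.one_mul]

/-- **`𝓔` is unital**: `𝓔(𝟙) = Σ_k (Γ V_k)⋆ (Γ V_k) = Γ(Σ_k V_k⋆ V_k) = 𝟙`. [cite: BratteliRobinsonII1997, §5.3.1] -/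
theorem krausMap_one (φ : Λ₀ ↪ Λ') {V : ι → Matrix (Finset (Orb Λ₀)) (Finset (Orb Λ₀)) ℂ}
    (hV : ∑ k, (V k)ᴴ * V k = 1) : krausMap φ V 1 = 1 :=
  krausMap_eq_self_of_commute φ hV fun _ => Commute.one_right _

/-- **Positivity**: `𝓔` maps positive semidefinite operators to positive semidefinite operators
(`W⋆ B W ⪰ 0` for `B ⪰ 0`). [cite: BratteliRobinsonII1997, §5.3.1 (complete positivity)] -/
theorem krausMap_posSemidef (φ : Λ₀ ↪ Λ') (V : ι → Matrix (Finset (Orb Λ₀)) (Finset (Orb Λ₀)) ℂ)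
    {B : Matrix (Finset (Orb Λ')) (Finset (Orb Λ')) ℂ} (hB : B.PosSemidef) :
    (krausMap φ V B).PosSemidef := by
  rw [krausMap_apply]
  exact Matrix.posSemidef_sum _ fun k _ => hB.conjTranspose_mul_mul_same _

open scoped MatrixOrder in
/-- Positivity in the Loewner order: `0 ≤ B → 0 ≤ 𝓔 B`. [cite: BratteliRobinsonII1997, §5.3.1] -/
theorem krausMap_nonneg (φ : Λ₀ ↪ Λ') (V : ι → Matrix (Finset (Orb Λ₀)) (Finset (Orb Λ₀)) ℂ)
    {B : Matrix (Finset (Orb Λ')) (Finset (Orb Λ')) ℂ} (hB : 0 ≤ B) : 0 ≤ krausMap φ V B :=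
  Matrix.nonneg_iff_posSemidef.2 (krausMap_posSemidef φ V (Matrix.nonneg_iff_posSemidef.1 hB))

/-- `𝓔` is a `*`-map: `(𝓔 B)⋆ = 𝓔 (B⋆)`. [cite: BratteliRobinsonII1997, §5.3.1] -/
theorem krausMap_conjTranspose (φ : Λ₀ ↪ Λ') (V : ι → Matrix (Finset (Orb Λ₀)) (Finset (Orb Λ₀)) ℂ)
    (B : Matrix (Finset (Orb Λ')) (Finset (Orb Λ')) ℂ) :
    (krausMap φ V B)ᴴ = krausMap φ V Bᴴ := by
  rw [krausMap_apply, krausMap_apply, Matrix.conjTranspose_sum]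
  exact Finset.sum_congr rfl fun k _ => by
    rw [Matrix.conjTranspose_mul, Matrix.conjTranspose_mul, Matrix.conjTranspose_conjTranspose,
      Matrix.mul_assoc]

/-- **`𝓔` commutes with the even–odd automorphism when every Kraus operator is homogeneous** (even
or odd): `Θ(𝓔 B) = 𝓔(Θ B)` (`Θ(W⋆ B W) = (±W)⋆ (ΘB) (±W)`).
[cite: BratteliRobinsonII1997, §5.2.2 (even and odd elements)] -/
theorem parityAut_krausMap (φ : Λ₀ ↪ Λ') {V : ι → Matrix (Finset (Orb Λ₀)) (Finset (Orb Λ₀)) ℂ}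
    (hV : ∀ k, parityAut (V k) = V k ∨ parityAut (V k) = -V k)
    (B : Matrix (Finset (Orb Λ')) (Finset (Orb Λ')) ℂ) :
    parityAut (krausMap φ V B) = krausMap φ V (parityAut B) := by
  rw [krausMap_apply, krausMap_apply, map_sum]
  refine Finset.sum_congr rfl fun k _ => ?_
  rw [map_mul, map_mul, parityAut_conjTranspose, ← fermionEmbed_parityAut]
  rcases hV k with h | h
  · rw [h]
  · rw [h, map_neg, Matrix.conjTranspose_neg, Matrix.neg_mul, Matrix.neg_mul, Matrix.mul_neg, neg_neg]

/-- **Covariance under further embeddings**: `Γ(ψ) (𝓔_φ B) = 𝓔_{φ∘ψ} (Γ(ψ) B)`.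
[cite: BratteliRobinsonII1997, §5.2.2 (isotony of the local algebras)] -/
theorem fermionEmbed_krausMap (φ : Λ₀ ↪ Λ') (ψ : Λ' ↪ Λ'') (V : ι → Matrix (Finset (Orb Λ₀)) (Finset (Orb Λ₀)) ℂ)
    (B : Matrix (Finset (Orb Λ')) (Finset (Orb Λ')) ℂ) :
    fermionEmbed ψ (krausMap φ V B) = krausMap (φ.trans ψ) V (fermionEmbed ψ B) := by
  rw [krausMap_apply, krausMap_apply, map_sum]
  exact Finset.sum_congr rfl fun k _ => by
    rw [map_mul, map_mul, fermionEmbed_conjTranspose, fermionEmbed_fermionEmbed]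

/-- **`𝓔` fixes even operators supported away from its Kraus operators**: for `ψ : Λ₂ ↪ Λ'` with image
disjoint from `φ Λ₀` and `Θ B = B`, `𝓔_φ (Γ(ψ) B) = Γ(ψ) B` (even elements of disjoint regions commute
with everything there). [cite: BratteliRobinsonII1997, §5.2.2 (even elements of disjoint regions commute)] -/
theorem krausMap_fermionEmbed_of_disjoint_of_even (φ : Λ₀ ↪ Λ') (ψ : Λ₂ ↪ Λ')
    (hdisj : Disjoint ((Finset.univ : Finset Λ₀).map φ) ((Finset.univ : Finset Λ₂).map ψ))
    {V : ι → Matrix (Finset (Orb Λ₀)) (Finset (Orb Λ₀)) ℂ} (hV : ∑ k, (V k)ᴴ * V k = 1)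
    {B : Matrix (Finset (Orb Λ₂)) (Finset (Orb Λ₂)) ℂ} (hB : parityAut B = B) :
    krausMap φ V (fermionEmbed ψ B) = fermionEmbed ψ B := by
  refine krausMap_eq_self_of_commute φ hV fun k => ?_
  exact (commute_of_mem_carEvenSubalgebra
    (fermionEmbed_mem_carEvenSubalgebra ψ (JordanWigner.mem_carEvenSubalgebra_univ_of_parityAut_eq hB))
    (fermionEmbed_mem_carSubalgebra φ (V k)) (disjoint_orbs hdisj.symm)).symm

/-- **If every Kraus operator is even, `𝓔` fixes ALL operators supported away from `φ Λ₀`.**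
[cite: BratteliRobinsonII1997, §5.2.2 (even elements of disjoint regions commute)] -/
theorem krausMap_fermionEmbed_of_disjoint_of_forall_even (φ : Λ₀ ↪ Λ') (ψ : Λ₂ ↪ Λ')
    (hdisj : Disjoint ((Finset.univ : Finset Λ₀).map φ) ((Finset.univ : Finset Λ₂).map ψ))
    {V : ι → Matrix (Finset (Orb Λ₀)) (Finset (Orb Λ₀)) ℂ} (hV : ∑ k, (V k)ᴴ * V k = 1)
    (hVe : ∀ k, parityAut (V k) = V k) (B : Matrix (Finset (Orb Λ₂)) (Finset (Orb Λ₂)) ℂ) :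
    krausMap φ V (fermionEmbed ψ B) = fermionEmbed ψ B := by
  refine krausMap_eq_self_of_commute φ hV fun k => ?_
  exact commute_of_mem_carEvenSubalgebra
    (fermionEmbed_mem_carEvenSubalgebra φ (JordanWigner.mem_carEvenSubalgebra_univ_of_parityAut_eq (hVe k)))
    (fermionEmbed_mem_carSubalgebra ψ B) (disjoint_orbs hdisj)

/-- Homogeneous operators of disjoint regions commute up to a common sign:
`Γ(φ₁) a · Γ(φ₂) b = ε Γ(φ₂) b · Γ(φ₁) a` and `(Γ(φ₁) a)⋆ · (Γ(φ₂) b)⋆ = ε (Γ(φ₂) b)⋆ · (Γ(φ₁) a)⋆` with the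
same `ε ∈ {1, -1}` (`ε = -1` iff both are odd). [cite: BratteliRobinsonII1997, §5.2.2 (graded commutation relations)] -/
private theorem exists_sign_mul_comm (φ₁ : Λ₁ ↪ Λ') (φ₂ : Λ₂ ↪ Λ')
    (hdisj : Disjoint ((Finset.univ : Finset Λ₁).map φ₁) ((Finset.univ : Finset Λ₂).map φ₂))
    {a : Matrix (Finset (Orb Λ₁)) (Finset (Orb Λ₁)) ℂ} (ha : parityAut a = a ∨ parityAut a = -a)
    {b : Matrix (Finset (Orb Λ₂)) (Finset (Orb Λ₂)) ℂ} (hb : parityAut b = b ∨ parityAut b = -b) :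
    ∃ ε : ℂ, (ε = 1 ∨ ε = -1) ∧
      fermionEmbed φ₁ a * fermionEmbed φ₂ b = ε • (fermionEmbed φ₂ b * fermionEmbed φ₁ a) ∧
      (fermionEmbed φ₁ a)ᴴ * (fermionEmbed φ₂ b)ᴴ = ε • ((fermionEmbed φ₂ b)ᴴ * (fermionEmbed φ₁ a)ᴴ) := by
  -- even `a`: commutes with everything from `Λ₂`
  rcases ha with ha | ha
  · refine ⟨1, Or.inl rfl, ?_, ?_⟩
    · rw [one_smul]
      exact (commute_of_mem_carEvenSubalgebra
        (fermionEmbed_mem_carEvenSubalgebra φ₁ (JordanWigner.mem_carEvenSubalgebra_univ_of_parityAut_eq ha))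
        (fermionEmbed_mem_carSubalgebra φ₂ b) (disjoint_orbs hdisj)).eq
    · rw [one_smul]
      have hae : parityAut aᴴ = aᴴ := by rw [parityAut_conjTranspose, ha]
      rw [← fermionEmbed_conjTranspose, ← fermionEmbed_conjTranspose]
      exact (commute_of_mem_carEvenSubalgebra
        (fermionEmbed_mem_carEvenSubalgebra φ₁ (JordanWigner.mem_carEvenSubalgebra_univ_of_parityAut_eq hae))
        (fermionEmbed_mem_carSubalgebra φ₂ bᴴ) (disjoint_orbs hdisj)).eq
  · rcases hb with hb | hb
    · -- odd `a`, even `b`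
      refine ⟨1, Or.inl rfl, ?_, ?_⟩
      · rw [one_smul]
        exact (commute_of_mem_carEvenSubalgebra
          (fermionEmbed_mem_carEvenSubalgebra φ₂ (JordanWigner.mem_carEvenSubalgebra_univ_of_parityAut_eq hb))
          (fermionEmbed_mem_carSubalgebra φ₁ a) (disjoint_orbs hdisj.symm)).eq.symm
      · rw [one_smul]
        have hbe : parityAut bᴴ = bᴴ := by rw [parityAut_conjTranspose, hb]
        rw [← fermionEmbed_conjTranspose, ← fermionEmbed_conjTranspose]
        exact (commute_of_mem_carEvenSubalgebra
          (fermionEmbed_mem_carEvenSubalgebra φ₂ (JordanWigner.mem_carEvenSubalgebra_univ_of_parityAut_eq hbe))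
          (fermionEmbed_mem_carSubalgebra φ₁ aᴴ) (disjoint_orbs hdisj.symm)).eq.symm
    · -- both odd: anticommute
      refine ⟨-1, Or.inr rfl, ?_, ?_⟩
      · rw [neg_one_smul]
        exact fermionEmbed_mul_fermionEmbed_of_odd_of_disjoint φ₁ φ₂ hdisj ha hb
      · rw [neg_one_smul]
        have hao : parityAut aᴴ = -aᴴ := by rw [parityAut_conjTranspose, ha, Matrix.conjTranspose_neg]
        have hbo : parityAut bᴴ = -bᴴ := by rw [parityAut_conjTranspose, hb, Matrix.conjTranspose_neg]
        rw [← fermionEmbed_conjTranspose, ← fermionEmbed_conjTranspose]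
        exact fermionEmbed_mul_fermionEmbed_of_odd_of_disjoint φ₁ φ₂ hdisj hao hbo

/-- **Kraus maps with disjoint supports and homogeneous Kraus operators commute** (pointwise form):
`𝓔_{φ₁}^V (𝓔_{φ₂}^W B) = 𝓔_{φ₂}^W (𝓔_{φ₁}^V B)` (the graded signs of `W_j V_k = ± V_k W_j` cancel against
those of the adjoints). [cite: BratteliRobinsonII1997, §5.2.2 (graded commutation relations)] -/
theorem krausMap_krausMap_comm_of_disjoint (φ₁ : Λ₁ ↪ Λ') (φ₂ : Λ₂ ↪ Λ')
    (hdisj : Disjoint ((Finset.univ : Finset Λ₁).map φ₁) ((Finset.univ : Finset Λ₂).map φ₂))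
    {V : ι → Matrix (Finset (Orb Λ₁)) (Finset (Orb Λ₁)) ℂ} (hV : ∀ k, parityAut (V k) = V k ∨ parityAut (V k) = -V k)
    {W : κ → Matrix (Finset (Orb Λ₂)) (Finset (Orb Λ₂)) ℂ} (hW : ∀ j, parityAut (W j) = W j ∨ parityAut (W j) = -W j)
    (B : Matrix (Finset (Orb Λ')) (Finset (Orb Λ')) ℂ) :
    krausMap φ₁ V (krausMap φ₂ W B) = krausMap φ₂ W (krausMap φ₁ V B) := by
  simp only [krausMap_apply, Finset.mul_sum, Finset.sum_mul]
  rw [Finset.sum_comm]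
  refine Finset.sum_congr rfl fun j _ => Finset.sum_congr rfl fun k _ => ?_
  obtain ⟨ε, -, hmul, hct⟩ := exists_sign_mul_comm φ₁ φ₂ hdisj (hV k) (hW j)
  -- `(V⋆ (W⋆ B W) V) = (V⋆ W⋆) B (W V)` versus `W⋆ (V⋆ B V) W = (W⋆ V⋆) B (V W)`
  calc (fermionEmbed φ₁ (V k))ᴴ * ((fermionEmbed φ₂ (W j))ᴴ * B * fermionEmbed φ₂ (W j)) *
        fermionEmbed φ₁ (V k)
      = ((fermionEmbed φ₁ (V k))ᴴ * (fermionEmbed φ₂ (W j))ᴴ) * B *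
          (fermionEmbed φ₂ (W j) * fermionEmbed φ₁ (V k)) := by simp only [Matrix.mul_assoc]
    _ = (ε • ((fermionEmbed φ₂ (W j))ᴴ * (fermionEmbed φ₁ (V k))ᴴ)) * B *
          (fermionEmbed φ₂ (W j) * fermionEmbed φ₁ (V k)) := by rw [hct]
    _ = ((fermionEmbed φ₂ (W j))ᴴ * (fermionEmbed φ₁ (V k))ᴴ) * B *
          (ε • (fermionEmbed φ₂ (W j) * fermionEmbed φ₁ (V k))) := by
        rw [Matrix.smul_mul, Matrix.smul_mul, Matrix.mul_smul]
    _ = ((fermionEmbed φ₂ (W j))ᴴ * (fermionEmbed φ₁ (V k))ᴴ) * B *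
          (fermionEmbed φ₁ (V k) * fermionEmbed φ₂ (W j)) := by rw [← hmul]
    _ = (fermionEmbed φ₂ (W j))ᴴ * ((fermionEmbed φ₁ (V k))ᴴ * B * fermionEmbed φ₁ (V k)) *
          fermionEmbed φ₂ (W j) := by simp only [Matrix.mul_assoc]

/-- **Kraus maps with disjoint supports and homogeneous Kraus operators commute** in the endomorphism
monoid of `𝔄_{Λ'}`. [cite: BratteliRobinsonII1997, §5.2.2 (graded commutation relations)] -/
theorem krausMap_comm_of_disjoint (φ₁ : Λ₁ ↪ Λ') (φ₂ : Λ₂ ↪ Λ')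
    (hdisj : Disjoint ((Finset.univ : Finset Λ₁).map φ₁) ((Finset.univ : Finset Λ₂).map φ₂))
    {V : ι → Matrix (Finset (Orb Λ₁)) (Finset (Orb Λ₁)) ℂ} (hV : ∀ k, parityAut (V k) = V k ∨ parityAut (V k) = -V k)
    {W : κ → Matrix (Finset (Orb Λ₂)) (Finset (Orb Λ₂)) ℂ} (hW : ∀ j, parityAut (W j) = W j ∨ parityAut (W j) = -W j) :
    Commute (krausMap φ₁ V) (krausMap φ₂ W) :=
  LinearMap.ext fun B => krausMap_krausMap_comm_of_disjoint φ₁ φ₂ hdisj hV hW B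

end Literature.MathematicalPhysics.QuantumLattice

end
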